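import Mathlib
import HarnessLib
import HarnessLib.Audit
import Summits.AtomisticToContinuum.Crystallization.Statement
import Summits.AtomisticToContinuum.Crystallization.Theses.PoissonBesselStacking
import Summits.AtomisticToContinuum.Crystallization.Theses.LaminarSixThreeThree
import Summits.AtomisticToContinuum.Crystallization.Theses.LuttingerTiszaRegistry
import Summits.AtomisticToContinuum.Crystallization.Theses.ThreeConeCertificate
import Summits.AtomisticToContinuum.Crystallization.Theses.FrustrationRangeCertificates
import Summits.AtomisticToContinuum.Crystallization.Theses.CrystalKissingRigidity
import Literature.MathematicalPhysics.StatisticalMechanics.BarlowStacking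

/-!
# Crux `BulkDefectVanish` (stmt-AtomisticToContinuum-0751) — birth skeleton (BC3)

Route `PoissonBesselStacking` (primary for this registration; the item is SHARED with identical
signature by `LuttingerTiszaRegistry`, `ThreeConeCertificate`, `FrustrationRangeCertificates` and
several support-only routes), sub-problem `Crystallization`, crux rank 4 — the POSITIONAL HINGE:

  `∃ P` periodic such that for all `R, ε > 0`, along every sequence of Lennard-Jones ground states
  in `ℝ³`, all but `o(N)` particles `i` admit a LINEAR isometry `A` with the particles of
  `B_R(x_i)` two-way `ε`-matched to `x_i + A(P.points ∩ B̄_R(0))` (un-based windows: the particle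
  sits at the image of the origin `0 ∈ P.points`).

## The line — three named stubs along the three scales of the positional half

The `(R, ε)`-bad set of the crux is covered by three sets, each of vanishing density:

* `stub_laminarBarlowWindows` — LAYERING (shared open physics): at every scale `(R', ε')`,
  `ε' < 1/4`, all but `o(N)` particles have their `R'`-window two-way `ε'`-matched (based at a
  stacking point `z`, chart `A`) to SOME Barlow stacking `barlowStacking a h s`, `a, h ∈ (1/2, 2)`,
  `s` any Hägg word. VERBATIM the signature of the open item `stmt-AtomisticToContinuum-14292`
  (`LaminarSixThreeThree.LaminarBarlowWindows`; also the stub of the registered skeleton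
  `Cruxes/BulkDefectVanishBased/Lines/birth.lean`), so it is discharged BY NAME when 14292 closes.
* `stub_stackingFaultSparsity` — STACKING SELECTION (where THIS route's engine acts): at every
  scale, the particles that ARE Barlow-matched but are matched to NO `hcpStacking a h`
  (`a, h ∈ (1/2, 2)`, based windows) number `o(N)`. VERBATIM the signature of the open item
  `stmt-AtomisticToContinuum-14296` (`LaminarSixThreeThree.StackingFaultSparsity`), whose docstring
  names the mechanism on file: each misaligned layer pair crossing the bulk costs
  `≥ |J₂| − Σ_{k≥3}(k−1)|J_k| ≥ |J₂|/2 > 1.8e−5` per column — `PoissonBesselStacking.LjRegistryDomination`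
  (item 3063, PROVED) fed into the Peierls count `HaggDominationAllRanges` (item 0737) — against the
  `O(N^{2/3})` surface budget, so `O(1)` fault planes and `o(N)` faulted windows.
* `stub_hcpTemplateLock` — ONE TEMPLATE (what the hinge demands beyond 14292 + 14296; new
  statement `HcpTemplateLock` below): ONE periodic `P` such that for every target scale `(R, ε)`
  there is a certification scale `(R', ε')`, `ε' < 1/4`, at which, along every ground-state
  sequence, the particles that ARE hcp-matched (free `(a, h)`, based window) at `(R', ε')` but are
  NOT matched to the un-based `P`-window at `(R, ε)` number `o(N)`. Content: (i) LATTICE-PARAMETER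
  LOCK — the per-particle spacings `(a, h)` of hcp-matched bulk regions concentrate at the unique
  minimiser `(a*, h*) ≈ (0.9712, 0.7930)` of the relaxed-hcp energy (strict stability of the hcp
  lattice sums in `(a, h)`: a region matched at parameters `δ`-off costs `≳ δ²` per particle against
  the `O(N^{2/3})` excess of a ground state, the `o(N)` non-hcp particles contributing at most
  `O(1)` each); (ii) UN-BASING — `hcpStacking a h` is linearly homogeneous through the origin:
  `0 = barlowPos 0 0 0 ∈ hcpStacking a h` and for every site `z`, `hcpStacking a h − z` is
  `hcpStacking a h` (same sublattice) or `−(hcpStacking a h)` (other sublattice: inversion centre at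
  `z/2`), so a based chart `(A, z)` becomes the un-based chart `A` or `A ∘ (−id)`; this is exactly
  the vertex-transitivity bet recorded in the item's why-might-fail (true for hcp, false for
  dhcp-type templates). Witness: `P := hcpPeriodicConfiguration a* h*` (`hcpPeriodicConfiguration_points`).
* `BulkDefectVanish_of` — the kernel-checked composition (real proof, no `sorry`):
  `stub₁-sig → stub₂-sig → stub₃-sig → PoissonBesselStacking.BulkDefectVanish` BY NAME: take the `P`
  of the template lock; for `(R, ε)` take its certification scale `(R', ε')`; then
  `{¬P-matched@(R,ε)} ⊆ {¬Barlow@(R',ε')} ∪ {Barlow ∧ ¬hcp @(R',ε')} ∪ {hcp@(R',ε') ∧ ¬P@(R,ε)}`,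
  union bound on `Nat.card` and a squeeze of densities (`tendsto_density_two_stage`, twice).
* `BulkDefectVanish_skeleton : PoissonBesselStacking.BulkDefectVanish` — the crux by name from the
  three stubs (the only `sorry`s in its cone are the three `stub_*`); the shared copies
  `LuttingerTiszaRegistry` / `ThreeConeCertificate` / `FrustrationRangeCertificates` are concluded
  by the same term (`_ofLT` / `_ofTCC` / `_ofFRC`, definitional unfolding), and so is the copy in the
  RETIRED route `CrystalKissingRigidity` (`_ofCKR` / `BulkDefectVanish_proof`), which is still the item's
  default decl for `ledger skeleton check` (first `wanted_by` entry).

`sorry` occurs ONLY inside the three `stub_*` theorems. All three stubs are CONSEQUENCES of the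
crux up to the layering input (crux ⇒ stub 3 with `(R', ε') := (R, min ε 1/8)`; 14292 ∧ 14296 are
the shared positional items every sphere-packing-heritage route wants), none is the crux or the
sub-problem in disguise (BC3 probes: `stub → BulkDefectVanish` and `stub → Crystallization` by
`first | exact? | simpa | aesop` all FAIL — see `Lines/birth.md`).

Disproof used: none on file (`ledger crux ls stmt-AtomisticToContinuum-0751`: no workfiles, no
`Disproof.lean`, no Negative lemmas, 2026-08-17). Negatives of the sub-problem — 4146 (1 %-tolerance
local Hales), 15929 (gapped 12-shell census), 3506 (one-grain gluing `∀ P`), 17253 (one-multiplier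
pricing) — are deterministic finite-configuration statements; none is an instance of the three
asymptotic `o(N)` stubs. Known tree fact bearing on the crux: `crystallization_of_bulkDefectVanish`
(ThreeConeCertificateKeplerBoundOfBulkDefectVanish.lean) — the crux ALONE closes the sub-problem,
so the informative object is this cut, not the crux.
-/

namespace Summit.AtomisticToContinuum.Crystallization.Cruxes.BulkDefectVanish.Birth

open Filter

/-! ## Generic counting glue (proved; same two lemmas as `Cruxes/BulkDefectVanishBased/Lines/birth.lean`) -/

/-- Union bound: a particle that is not `G`-good is either not `B`-good, or `B`-good and not
`G`-good. [folklore] -/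
theorem natCard_not_le_add {N : ℕ} (B G : Fin N → Prop) :
    Nat.card {i : Fin N // ¬ G i} ≤
      Nat.card {i : Fin N // ¬ B i} + Nat.card {i : Fin N // B i ∧ ¬ G i} := by
  calc Nat.card {i : Fin N // ¬ G i} = ({i | ¬ G i} : Set (Fin N)).ncard := rfl
    _ ≤ ({i | ¬ B i} ∪ {i | B i ∧ ¬ G i} : Set (Fin N)).ncard := by
        refine Set.ncard_le_ncard (fun i hi => ?_)
        simp only [Set.mem_setOf_eq, Set.mem_union] at hi ⊢
        by_cases hB : B i
        · exact Or.inr ⟨hB, hi⟩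
        · exact Or.inl hB
    _ ≤ ({i | ¬ B i} : Set (Fin N)).ncard + ({i | B i ∧ ¬ G i} : Set (Fin N)).ncard :=
        Set.ncard_union_le _ _
    _ = Nat.card {i : Fin N // ¬ B i} + Nat.card {i : Fin N // B i ∧ ¬ G i} := rfl

/-- Two-stage density bound: if the density of non-`B` particles and the density of
`B`-but-not-`G` particles both tend to `0`, so does the density of non-`G` particles. [folklore] -/
theorem tendsto_density_two_stage (B G : (N : ℕ) → Fin N → Prop)
    (hB : Tendsto (fun N : ℕ => (Nat.card {i : Fin N // ¬ B N i} : ℝ) / N) atTop (nhds 0))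
    (hBG : Tendsto (fun N : ℕ => (Nat.card {i : Fin N // B N i ∧ ¬ G N i} : ℝ) / N)
      atTop (nhds 0)) :
    Tendsto (fun N : ℕ => (Nat.card {i : Fin N // ¬ G N i} : ℝ) / N) atTop (nhds 0) := by
  have hsum : Tendsto (fun N : ℕ => (Nat.card {i : Fin N // ¬ B N i} : ℝ) / N +
      (Nat.card {i : Fin N // B N i ∧ ¬ G N i} : ℝ) / N) atTop (nhds 0) := by
    simpa only [add_zero] using hB.add hBG
  refine squeeze_zero (fun N => by positivity) (fun N => ?_) hsum
  rw [← add_div]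
  gcongr
  exact_mod_cast natCard_not_le_add (B N) (G N)

/-! ## The stubs -/

/-- **Stub 1 — LAYERING (laminar Barlow windows).** For all `R > 0`, `ε ∈ (0, 1/4)` and every
sequence of Lennard-Jones ground states, the fraction of particles `i` whose `R`-window is NOT
two-way `ε`-matched (after `x ↦ x_i + A(· − z)`, `A` a linear isometry, `z` a stacking point) to
`barlowStacking a h s` for some `a, h ∈ (1/2, 2)` and Hägg sequence `s` tends to `0`.
VERBATIM the signature of the open item `stmt-AtomisticToContinuum-14292`
(`LaminarSixThreeThree.LaminarBarlowWindows`). Why plausibly true: soft twelve-coordination of bulk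
particles (Flyspeck `L12` cap + LJ bond counting) and a robust local Hales step at tolerance
`≤ 1/400` (never the refuted `1/100` form, negatives 4146) make a.e. bulk window a Barlow fragment;
it is the positional content every sphere-packing-heritage route of the sub-problem bets on.
Size XL (open in print, Blanc–Lewin 2015 §2.3). -/
theorem stub_laminarBarlowWindows : ∀ R ε : ℝ, 0 < R → 0 < ε → ε < 1 / 4 → ∀ x : (N : ℕ) → (Fin N → EuclideanSpace ℝ (Fin 3)), (∀ N, Literature.MathematicalPhysics.StatisticalMechanics.IsGroundState Literature.MathematicalPhysics.StatisticalMechanics.lennardJones (x N)) → Filter.Tendsto (fun N : ℕ => (Nat.card {i : Fin N // ¬ (∃ a h : ℝ, 1 / 2 < a ∧ a < 2 ∧ 1 / 2 < h ∧ h < 2 ∧ ∃ s : ℤ → ℤ, Literature.MathematicalPhysics.StatisticalMechanics.IsHaggSeq s ∧ ∃ z ∈ Literature.MathematicalPhysics.StatisticalMechanics.barlowStacking a h s, ∃ A : EuclideanSpace ℝ (Fin 3) →ₗᵢ[ℝ] EuclideanSpace ℝ (Fin 3), (∀ p ∈ Literature.MathematicalPhysics.StatisticalMechanics.barlowStacking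 a h s, dist p z ≤ R → ∃ j : Fin N, dist (x N j) (x N i + A (p - z)) ≤ ε) ∧ (∀ j : Fin N, dist (x N j) (x N i) ≤ R → ∃ p ∈ Literature.MathematicalPhysics.StatisticalMechanics.barlowStacking a h s, dist (x N j) (x N i + A (p - z)) ≤ ε))} : ℝ) / N) Filter.atTop (nhds 0) := by
  sorry

/-- **Stub 2 — STACKING SELECTION (stacking-fault sparsity).** For all `R > 0`, `ε ∈ (0, 1/4)`
and every sequence of Lennard-Jones ground states, the fraction of particles whose `R`-window IS
two-way `ε`-matched to some Barlow stacking but to NO `hcpStacking a h` (`a, h ∈ (1/2, 2)`, based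
window, linear chart) tends to `0`. VERBATIM the signature of the open item
`stmt-AtomisticToContinuum-14296` (`LaminarSixThreeThree.StackingFaultSparsity`). Why plausibly
true (this route's engine): by `PoissonBesselStacking.LjRegistryDomination` (item 3063, PROVED:
`J₂ < 0`, `Σ_{k≥3}(k−1)|J_k| ≤ |J₂|/2` on the box `B`) and the Peierls count
`HaggDominationAllRanges` (item 0737), every misaligned layer pair crossing a Barlow-matched bulk
region costs `≥ |J₂|/2 > 1.8e−5` per column, while a ground state exceeds `N·e_∞` by `O(N^{2/3})`
only: `O(1)` fault planes meeting the bulk, hence `o(N)` windows containing a fault. Fails iff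
faults buy surface-shape gains extensively or the optimal stacking is not period 2.
Size XL. -/
theorem stub_stackingFaultSparsity : ∀ R ε : ℝ, 0 < R → 0 < ε → ε < 1 / 4 → ∀ x : (N : ℕ) → (Fin N → EuclideanSpace ℝ (Fin 3)), (∀ N, Literature.MathematicalPhysics.StatisticalMechanics.IsGroundState Literature.MathematicalPhysics.StatisticalMechanics.lennardJones (x N)) → Filter.Tendsto (fun N : ℕ => (Nat.card {i : Fin N // (∃ a h : ℝ, 1 / 2 < a ∧ a < 2 ∧ 1 / 2 < h ∧ h < 2 ∧ ∃ s : ℤ → ℤ, Literature.MathematicalPhysics.StatisticalMechanics.IsHaggSeq s ∧ ∃ z ∈ Literature.MathematicalPhysics.StatisticalMechanics.barlowStacking a h s, ∃ A : EuclideanSpace ℝ (Fin 3) →ₗᵢ[ℝ] EuclideanSpace ℝ (Fin 3), (∀ p ∈ Literature.MathematicalPhysics.StatisticalMechanics.barlowStacking a h s, dist p z ≤ R → ∃ j : Fin N, dist (x N j) (x N i + A (p - z)) ≤ ε) ∧ (∀ j : Fin N, dist (x N j) (x N i) ≤ R → ∃ p ∈ Literature.MathematicalPhysics.StatisticalMechanics.barlowStacking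 a h s, dist (x N j) (x N i + A (p - z)) ≤ ε)) ∧ ¬ (∃ a h : ℝ, 1 / 2 < a ∧ a < 2 ∧ 1 / 2 < h ∧ h < 2 ∧ ∃ z ∈ Literature.MathematicalPhysics.StatisticalMechanics.hcpStacking a h, ∃ A : EuclideanSpace ℝ (Fin 3) →ₗᵢ[ℝ] EuclideanSpace ℝ (Fin 3), (∀ p ∈ Literature.MathematicalPhysics.StatisticalMechanics.hcpStacking a h, dist p z ≤ R → ∃ j : Fin N, dist (x N j) (x N i + A (p - z)) ≤ ε) ∧ (∀ j : Fin N, dist (x N j) (x N i) ≤ R → ∃ p ∈ Literature.MathematicalPhysics.StatisticalMechanics.hcpStacking a h, dist (x N j) (x N i + A (p - z)) ≤ ε))} : ℝ) / N) Filter.atTop (nhds 0) := by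
  sorry

/-- **Statement of stub 3 — ONE TEMPLATE (hcp template lock, two scales).** There is ONE periodic
configuration `P` of `ℝ³` such that for every window radius `R > 0` and tolerance `ε > 0` there are
a certification radius `R' > 0` and tolerance `ε' ∈ (0, 1/4)` such that, along every sequence of
Lennard-Jones ground states, the fraction of particles `i` whose `R'`-window IS two-way
`ε'`-matched to some `hcpStacking a h` (`a, h ∈ (1/2, 2)`, based at a site `z`, linear chart `A`;
the predicate of item 14296) but whose `R`-window is NOT two-way `ε`-matched to the UN-BASED window
`x_i + A'(P.points ∩ B̄_R(0))` for any linear isometry `A'` (the predicate of the crux) tends to `0`.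
Intended witness: `P = hcpPeriodicConfiguration a* h*` at the relaxed-hcp optimum, `R' ≍ R`,
`ε' ≍ ε / R`. -/
def HcpTemplateLock : Prop :=
  ∃ P : Literature.MathematicalPhysics.StatisticalMechanics.PeriodicConfiguration 3, ∀ R ε : ℝ, 0 < R → 0 < ε → ∃ R' ε' : ℝ, 0 < R' ∧ 0 < ε' ∧ ε' < 1 / 4 ∧ ∀ x : (N : ℕ) → (Fin N → EuclideanSpace ℝ (Fin 3)), (∀ N, Literature.MathematicalPhysics.StatisticalMechanics.IsGroundState Literature.MathematicalPhysics.StatisticalMechanics.lennardJones (x N)) → Filter.Tendsto (fun N : ℕ => (Nat.card {i : Fin N // (∃ a h : ℝ, 1 / 2 < a ∧ a < 2 ∧ 1 / 2 < h ∧ h < 2 ∧ ∃ z ∈ Literature.MathematicalPhysics.StatisticalMechanics.hcpStacking a h, ∃ A : EuclideanSpace ℝ (Fin 3) →ₗᵢ[ℝ] EuclideanSpace ℝ (Fin 3), (∀ p ∈ Literature.MathematicalPhysics.StatisticalMechanics.hcpStacking a h, dist p z ≤ R' → ∃ j : Fin N, dist (x N j) (x N i + A (p - z)) ≤ ε') ∧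 (∀ j : Fin N, dist (x N j) (x N i) ≤ R' → ∃ p ∈ Literature.MathematicalPhysics.StatisticalMechanics.hcpStacking a h, dist (x N j) (x N i + A (p - z)) ≤ ε')) ∧ ¬ (∃ A : EuclideanSpace ℝ (Fin 3) →ₗᵢ[ℝ] EuclideanSpace ℝ (Fin 3), (∀ p ∈ P.points, ‖p‖ ≤ R → ∃ j : Fin N, dist (x N j) (x N i + A p) ≤ ε) ∧ (∀ j : Fin N, dist (x N j) (x N i) ≤ R → ∃ p ∈ P.points, dist (x N j) (x N i + A p) ≤ ε))} : ℝ) / N) Filter.atTop (nhds 0)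

/-- **Stub 3 — ONE TEMPLATE** (the statement `HcpTemplateLock`, inlined verbatim so that the
registered signature is self-contained). Why plausibly true: (i) lattice-parameter lock — an
hcp-matched bulk region at parameters `(a, h)` off the relaxed-hcp optimum `(a*, h*)` by `δ` costs
`≳ δ²` per particle (strict stability of the hcp Lennard-Jones lattice sums in `(a, h)`; the optimum
is non-degenerate and lies inside the box `B` of the route) while a ground state exceeds `N·e_∞` by
`O(N^{2/3})` and the `o(N)` non-hcp particles lower the bill by at most `O(1)` each, so for fixed
`δ = δ(R, ε)` the off-parameter hcp particles are `o(N)`; (ii) un-basing — `0 ∈ hcpStacking a h`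
and `hcpStacking a h − z ∈ {hcpStacking a h, −hcpStacking a h}` for every site `z` (lattice
translation, resp. the inversion centre at `z/2` between adjacent layers), so a based chart `(A, z)`
at `(R', ε')` with `|a − a*|, |h − h*| ≤ δ` yields the un-based chart `A` or `A ∘ (−id)` for
`P = hcp(a*, h*)` at `(R, ε)` once `R' ≥ R + 1`, `ε' + C R δ ≤ ε`. Fails iff ground states carry
extensive wrong-parameter hcp grains (degenerate `(a, h)`-minimiser) or the template had two
inequivalent site classes (not the case for hcp). Size L. Leans on: `hcpPeriodicConfiguration`,
`hcpPeriodicConfiguration_points`, `barlowPos`, `hcp_layer_add_two`, `CrysEnergyLimit_holds` +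
the trial-state upper bound (surface budget), `LennardJonesMinimalDistance_holds`. -/
theorem stub_hcpTemplateLock : ∃ P : Literature.MathematicalPhysics.StatisticalMechanics.PeriodicConfiguration 3, ∀ R ε : ℝ, 0 < R → 0 < ε → ∃ R' ε' : ℝ, 0 < R' ∧ 0 < ε' ∧ ε' < 1 / 4 ∧ ∀ x : (N : ℕ) → (Fin N → EuclideanSpace ℝ (Fin 3)), (∀ N, Literature.MathematicalPhysics.StatisticalMechanics.IsGroundState Literature.MathematicalPhysics.StatisticalMechanics.lennardJones (x N)) → Filter.Tendsto (fun N : ℕ => (Nat.card {i : Fin N // (∃ a h : ℝ, 1 / 2 < a ∧ a < 2 ∧ 1 / 2 < h ∧ h < 2 ∧ ∃ z ∈ Literature.MathematicalPhysics.StatisticalMechanics.hcpStacking a h, ∃ A : EuclideanSpace ℝ (Fin 3) →ₗᵢ[ℝ] EuclideanSpace ℝ (Fin 3), (∀ p ∈ Literature.MathematicalPhysics.StatisticalMechanics.hcpStacking a h, dist p z ≤ R' → ∃ j : Fin N, dist (x N j) (x N i + A (p - z)) ≤ ε') ∧ (∀ j : Fin N, dist (x N j) (x N i) ≤ R' → ∃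 p ∈ Literature.MathematicalPhysics.StatisticalMechanics.hcpStacking a h, dist (x N j) (x N i + A (p - z)) ≤ ε')) ∧ ¬ (∃ A : EuclideanSpace ℝ (Fin 3) →ₗᵢ[ℝ] EuclideanSpace ℝ (Fin 3), (∀ p ∈ P.points, ‖p‖ ≤ R → ∃ j : Fin N, dist (x N j) (x N i + A p) ≤ ε) ∧ (∀ j : Fin N, dist (x N j) (x N i) ≤ R → ∃ p ∈ P.points, dist (x N j) (x N i + A p) ≤ ε))} : ℝ) / N) Filter.atTop (nhds 0) := by
  sorry

/-! ## The composition (kernel-checked, no sorry) -/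

/-- **Composition** `stub₁-sig → stub₂-sig → stub₃-sig → PoissonBesselStacking.BulkDefectVanish`
(the crux BY NAME), real proof: take the `P` of the template lock; for a target scale `(R, ε)` take
its certification scale `(R', ε')`; the `(R, ε)`-bad particles of the crux are covered by the
non-Barlow particles at `(R', ε')` (stub 1), the Barlow-but-not-hcp particles at `(R', ε')`
(stub 2) and the hcp-but-not-`P` particles (stub 3): two applications of
`tendsto_density_two_stage`. -/
theorem BulkDefectVanish_of : (∀ R ε : ℝ, 0 < R → 0 < ε → ε < 1 / 4 → ∀ x : (N : ℕ) → (Fin N → EuclideanSpace ℝ (Fin 3)), (∀ N, Literature.MathematicalPhysics.StatisticalMechanics.IsGroundState Literature.MathematicalPhysics.StatisticalMechanics.lennardJones (x N)) → Filter.Tendsto (fun N : ℕ => (Nat.card {i : Fin N // ¬ (∃ a h : ℝ, 1 / 2 < a ∧ a < 2 ∧ 1 / 2 < h ∧ h < 2 ∧ ∃ s : ℤ → ℤ, Literature.MathematicalPhysics.StatisticalMechanics.IsHaggSeq s ∧ ∃ z ∈ Literature.MathematicalPhysics.StatisticalMechanics.barlowStacking a h s, ∃ A : EuclideanSpace ℝ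 (Fin 3) →ₗᵢ[ℝ] EuclideanSpace ℝ (Fin 3), (∀ p ∈ Literature.MathematicalPhysics.StatisticalMechanics.barlowStacking a h s, dist p z ≤ R → ∃ j : Fin N, dist (x N j) (x N i + A (p - z)) ≤ ε) ∧ (∀ j : Fin N, dist (x N j) (x N i) ≤ R → ∃ p ∈ Literature.MathematicalPhysics.StatisticalMechanics.barlowStacking a h s, dist (x N j) (x N i + A (p - z)) ≤ ε))} : ℝ) / N) Filter.atTop (nhds 0)) → (∀ R ε : ℝ, 0 < R → 0 < ε → ε < 1 / 4 → ∀ x : (N : ℕ) → (Fin N → EuclideanSpace ℝ (Fin 3)), (∀ N, Literature.MathematicalPhysics.StatisticalMechanics.IsGroundState Literature.MathematicalPhysics.StatisticalMechanics.lennardJones (x N)) → Filter.Tendsto (fun N : ℕ => (Nat.card {i : Fin N // (∃ a h : ℝ, 1 / 2 < a ∧ a < 2 ∧ 1 / 2 < h ∧ h < 2 ∧ ∃ s : ℤ → ℤ, Literature.MathematicalPhysics.StatisticalMechanics.IsHaggSeq s ∧ ∃ z ∈ Literature.MathematicalPhysics.StatisticalMechanics.barlowStacking a h s, ∃ A : EuclideanSpace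 ℝ (Fin 3) →ₗᵢ[ℝ] EuclideanSpace ℝ (Fin 3), (∀ p ∈ Literature.MathematicalPhysics.StatisticalMechanics.barlowStacking a h s, dist p z ≤ R → ∃ j : Fin N, dist (x N j) (x N i + A (p - z)) ≤ ε) ∧ (∀ j : Fin N, dist (x N j) (x N i) ≤ R → ∃ p ∈ Literature.MathematicalPhysics.StatisticalMechanics.barlowStacking a h s, dist (x N j) (x N i + A (p - z)) ≤ ε)) ∧ ¬ (∃ a h : ℝ, 1 / 2 < a ∧ a < 2 ∧ 1 / 2 < h ∧ h < 2 ∧ ∃ z ∈ Literature.MathematicalPhysics.StatisticalMechanics.hcpStacking a h, ∃ A : EuclideanSpace ℝ (Fin 3) →ₗᵢ[ℝ] EuclideanSpace ℝ (Fin 3), (∀ p ∈ Literature.MathematicalPhysics.StatisticalMechanics.hcpStacking a h, dist p z ≤ R → ∃ j : Fin N, dist (x N j) (x N i + A (p - z)) ≤ ε) ∧ (∀ j : Fin N, dist (x N j) (x N i) ≤ R → ∃ p ∈ Literature.MathematicalPhysics.StatisticalMechanics.hcpStacking a h, dist (x N j) (x N i + A (p - z)) ≤ ε))} : ℝ) /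 N) Filter.atTop (nhds 0)) → (∃ P : Literature.MathematicalPhysics.StatisticalMechanics.PeriodicConfiguration 3, ∀ R ε : ℝ, 0 < R → 0 < ε → ∃ R' ε' : ℝ, 0 < R' ∧ 0 < ε' ∧ ε' < 1 / 4 ∧ ∀ x : (N : ℕ) → (Fin N → EuclideanSpace ℝ (Fin 3)), (∀ N, Literature.MathematicalPhysics.StatisticalMechanics.IsGroundState Literature.MathematicalPhysics.StatisticalMechanics.lennardJones (x N)) → Filter.Tendsto (fun N : ℕ => (Nat.card {i : Fin N // (∃ a h : ℝ, 1 / 2 < a ∧ a < 2 ∧ 1 / 2 < h ∧ h < 2 ∧ ∃ z ∈ Literature.MathematicalPhysics.StatisticalMechanics.hcpStacking a h, ∃ A : EuclideanSpace ℝ (Fin 3) →ₗᵢ[ℝ] EuclideanSpace ℝ (Fin 3), (∀ p ∈ Literature.MathematicalPhysics.StatisticalMechanics.hcpStacking a h, dist p z ≤ R' → ∃ j : Fin N, dist (x N j) (x N i + A (p - z)) ≤ ε') ∧ (∀ j : Fin N, dist (x N j) (x N i) ≤ R' → ∃ p ∈ Literature.MathematicalPhysics.StatisticalMechanics.hcpStacking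 a h, dist (x N j) (x N i + A (p - z)) ≤ ε')) ∧ ¬ (∃ A : EuclideanSpace ℝ (Fin 3) →ₗᵢ[ℝ] EuclideanSpace ℝ (Fin 3), (∀ p ∈ P.points, ‖p‖ ≤ R → ∃ j : Fin N, dist (x N j) (x N i + A p) ≤ ε) ∧ (∀ j : Fin N, dist (x N j) (x N i) ≤ R → ∃ p ∈ P.points, dist (x N j) (x N i + A p) ≤ ε))} : ℝ) / N) Filter.atTop (nhds 0)) → Summit.AtomisticToContinuum.Crystallization.Theses.PoissonBesselStacking.BulkDefectVanish := by
  intro hL hF hS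
  obtain ⟨P, hP⟩ := hS
  refine ⟨P, fun R ε hR hε x hx => ?_⟩
  obtain ⟨R', ε', hR', hε', hε'4, hS'⟩ := hP R ε hR hε
  exact tendsto_density_two_stage _ _
    (tendsto_density_two_stage _ _ (hL R' ε' hR' hε' hε'4 x hx) (hF R' ε' hR' hε' hε'4 x hx))
    (hS' x hx)

/-- **The crux BY NAME from the three stubs** (type literally the route decl; the only `sorry`s in
its cone are `stub_laminarBarlowWindows`, `stub_stackingFaultSparsity`, `stub_hcpTemplateLock`). -/
theorem BulkDefectVanish_skeleton : Summit.AtomisticToContinuum.Crystallization.Theses.PoissonBesselStacking.BulkDefectVanish :=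
  BulkDefectVanish_of stub_laminarBarlowWindows stub_stackingFaultSparsity stub_hcpTemplateLock

/-- By-name reading of the composition: items 14292, 14296 and the named statement
`HcpTemplateLock` imply the crux decl (certifies that the inlined signatures of
`BulkDefectVanish_of` are definitionally these named statements). -/
example : Summit.AtomisticToContinuum.Crystallization.Theses.LaminarSixThreeThree.LaminarBarlowWindows →
    Summit.AtomisticToContinuum.Crystallization.Theses.LaminarSixThreeThree.StackingFaultSparsity → HcpTemplateLock →
    Summit.AtomisticToContinuum.Crystallization.Theses.PoissonBesselStacking.BulkDefectVanish :=
  fun hL hF hS => BulkDefectVanish_of hL hF hS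

/-- The registered stub signatures are, definitionally, item 14292's decl, item 14296's decl and
`HcpTemplateLock`. -/
example : Summit.AtomisticToContinuum.Crystallization.Theses.LaminarSixThreeThree.LaminarBarlowWindows ∧
    Summit.AtomisticToContinuum.Crystallization.Theses.LaminarSixThreeThree.StackingFaultSparsity ∧ HcpTemplateLock :=
  ⟨stub_laminarBarlowWindows, stub_stackingFaultSparsity, stub_hcpTemplateLock⟩

/-! ### The shared copies of the crux (identical signatures; definitional unfolding) -/

/-- Same composition, concluding the `LuttingerTiszaRegistry` copy of the shared item 0751. -/
theorem BulkDefectVanish_ofLT : (∀ R ε : ℝ, 0 < R → 0 < ε → ε < 1 / 4 → ∀ x : (N : ℕ) → (Fin N → EuclideanSpace ℝ (Fin 3)), (∀ N, Literature.MathematicalPhysics.StatisticalMechanics.IsGroundState Literature.MathematicalPhysics.StatisticalMechanics.lennardJones (x N)) → Filter.Tendsto (fun N : ℕ => (Nat.card {i : Fin N // ¬ (∃ a h : ℝ, 1 / 2 < a ∧ a < 2 ∧ 1 / 2 < h ∧ h < 2 ∧ ∃ s : ℤ → ℤ, Literature.MathematicalPhysics.StatisticalMechanics.IsHaggSeq s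 ∧ ∃ z ∈ Literature.MathematicalPhysics.StatisticalMechanics.barlowStacking a h s, ∃ A : EuclideanSpace ℝ (Fin 3) →ₗᵢ[ℝ] EuclideanSpace ℝ (Fin 3), (∀ p ∈ Literature.MathematicalPhysics.StatisticalMechanics.barlowStacking a h s, dist p z ≤ R → ∃ j : Fin N, dist (x N j) (x N i + A (p - z)) ≤ ε) ∧ (∀ j : Fin N, dist (x N j) (x N i) ≤ R → ∃ p ∈ Literature.MathematicalPhysics.StatisticalMechanics.barlowStacking a h s, dist (x N j) (x N i + A (p - z)) ≤ ε))} : ℝ) / N) Filter.atTop (nhds 0)) → (∀ R ε : ℝ, 0 < R → 0 < ε → ε < 1 / 4 → ∀ x : (N : ℕ) → (Fin N → EuclideanSpace ℝ (Fin 3)), (∀ N, Literature.MathematicalPhysics.StatisticalMechanics.IsGroundState Literature.MathematicalPhysics.StatisticalMechanics.lennardJones (x N)) → Filter.Tendsto (fun N : ℕ => (Nat.card {i : Fin N // (∃ a h : ℝ, 1 / 2 < a ∧ a < 2 ∧ 1 / 2 < h ∧ h < 2 ∧ ∃ s : ℤ → ℤ, Literature.MathematicalPhysics.StatisticalMechanics.IsHaggSeq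 s ∧ ∃ z ∈ Literature.MathematicalPhysics.StatisticalMechanics.barlowStacking a h s, ∃ A : EuclideanSpace ℝ (Fin 3) →ₗᵢ[ℝ] EuclideanSpace ℝ (Fin 3), (∀ p ∈ Literature.MathematicalPhysics.StatisticalMechanics.barlowStacking a h s, dist p z ≤ R → ∃ j : Fin N, dist (x N j) (x N i + A (p - z)) ≤ ε) ∧ (∀ j : Fin N, dist (x N j) (x N i) ≤ R → ∃ p ∈ Literature.MathematicalPhysics.StatisticalMechanics.barlowStacking a h s, dist (x N j) (x N i + A (p - z)) ≤ ε)) ∧ ¬ (∃ a h : ℝ, 1 / 2 < a ∧ a < 2 ∧ 1 / 2 < h ∧ h < 2 ∧ ∃ z ∈ Literature.MathematicalPhysics.StatisticalMechanics.hcpStacking a h, ∃ A : EuclideanSpace ℝ (Fin 3) →ₗᵢ[ℝ] EuclideanSpace ℝ (Fin 3), (∀ p ∈ Literature.MathematicalPhysics.StatisticalMechanics.hcpStacking a h, dist p z ≤ R → ∃ j : Fin N, dist (x N j) (x N i + A (p - z)) ≤ ε) ∧ (∀ j : Fin N, dist (x N j) (x N i) ≤ R → ∃ p ∈ Literature.MathematicalPhysics.StatisticalMechanics.hcpStacking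 a h, dist (x N j) (x N i + A (p - z)) ≤ ε))} : ℝ) / N) Filter.atTop (nhds 0)) → (∃ P : Literature.MathematicalPhysics.StatisticalMechanics.PeriodicConfiguration 3, ∀ R ε : ℝ, 0 < R → 0 < ε → ∃ R' ε' : ℝ, 0 < R' ∧ 0 < ε' ∧ ε' < 1 / 4 ∧ ∀ x : (N : ℕ) → (Fin N → EuclideanSpace ℝ (Fin 3)), (∀ N, Literature.MathematicalPhysics.StatisticalMechanics.IsGroundState Literature.MathematicalPhysics.StatisticalMechanics.lennardJones (x N)) → Filter.Tendsto (fun N : ℕ => (Nat.card {i : Fin N // (∃ a h : ℝ, 1 / 2 < a ∧ a < 2 ∧ 1 / 2 < h ∧ h < 2 ∧ ∃ z ∈ Literature.MathematicalPhysics.StatisticalMechanics.hcpStacking a h, ∃ A : EuclideanSpace ℝ (Fin 3) →ₗᵢ[ℝ] EuclideanSpace ℝ (Fin 3), (∀ p ∈ Literature.MathematicalPhysics.StatisticalMechanics.hcpStacking a h, dist p z ≤ R' → ∃ j : Fin N, dist (x N j) (x N i + A (p - z)) ≤ ε') ∧ (∀ j : Fin N, dist (x N j) (x N i) ≤ R'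 → ∃ p ∈ Literature.MathematicalPhysics.StatisticalMechanics.hcpStacking a h, dist (x N j) (x N i + A (p - z)) ≤ ε')) ∧ ¬ (∃ A : EuclideanSpace ℝ (Fin 3) →ₗᵢ[ℝ] EuclideanSpace ℝ (Fin 3), (∀ p ∈ P.points, ‖p‖ ≤ R → ∃ j : Fin N, dist (x N j) (x N i + A p) ≤ ε) ∧ (∀ j : Fin N, dist (x N j) (x N i) ≤ R → ∃ p ∈ P.points, dist (x N j) (x N i + A p) ≤ ε))} : ℝ) / N) Filter.atTop (nhds 0)) → Summit.AtomisticToContinuum.Crystallization.Theses.LuttingerTiszaRegistry.BulkDefectVanish :=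
  fun hL hF hS => BulkDefectVanish_of hL hF hS

/-- Same composition, concluding the `ThreeConeCertificate` copy of the shared item 0751. -/
theorem BulkDefectVanish_ofTCC : (∀ R ε : ℝ, 0 < R → 0 < ε → ε < 1 / 4 → ∀ x : (N : ℕ) → (Fin N → EuclideanSpace ℝ (Fin 3)), (∀ N, Literature.MathematicalPhysics.StatisticalMechanics.IsGroundState Literature.MathematicalPhysics.StatisticalMechanics.lennardJones (x N)) → Filter.Tendsto (fun N : ℕ => (Nat.card {i : Fin N // ¬ (∃ a h : ℝ, 1 / 2 < a ∧ a < 2 ∧ 1 / 2 < h ∧ h < 2 ∧ ∃ s : ℤ → ℤ, Literature.MathematicalPhysics.StatisticalMechanics.IsHaggSeq s ∧ ∃ z ∈ Literature.MathematicalPhysics.StatisticalMechanics.barlowStacking a h s, ∃ A : EuclideanSpace ℝ (Fin 3) →ₗᵢ[ℝ] EuclideanSpace ℝ (Fin 3), (∀ p ∈ Literature.MathematicalPhysics.StatisticalMechanics.barlowStacking a h s, dist p z ≤ R → ∃ j : Fin N, dist (x N j) (x N i + A (p - z)) ≤ ε) ∧ (∀ j : Fin N, dist (x N j) (x N i) ≤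 R → ∃ p ∈ Literature.MathematicalPhysics.StatisticalMechanics.barlowStacking a h s, dist (x N j) (x N i + A (p - z)) ≤ ε))} : ℝ) / N) Filter.atTop (nhds 0)) → (∀ R ε : ℝ, 0 < R → 0 < ε → ε < 1 / 4 → ∀ x : (N : ℕ) → (Fin N → EuclideanSpace ℝ (Fin 3)), (∀ N, Literature.MathematicalPhysics.StatisticalMechanics.IsGroundState Literature.MathematicalPhysics.StatisticalMechanics.lennardJones (x N)) → Filter.Tendsto (fun N : ℕ => (Nat.card {i : Fin N // (∃ a h : ℝ, 1 / 2 < a ∧ a < 2 ∧ 1 / 2 < h ∧ h < 2 ∧ ∃ s : ℤ → ℤ, Literature.MathematicalPhysics.StatisticalMechanics.IsHaggSeq s ∧ ∃ z ∈ Literature.MathematicalPhysics.StatisticalMechanics.barlowStacking a h s, ∃ A : EuclideanSpace ℝ (Fin 3) →ₗᵢ[ℝ] EuclideanSpace ℝ (Fin 3), (∀ p ∈ Literature.MathematicalPhysics.StatisticalMechanics.barlowStacking a h s, dist p z ≤ R → ∃ j : Fin N, dist (x N j) (x N i + A (p - z)) ≤ ε) ∧ (∀ j : Fin N, dist (x N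 j) (x N i) ≤ R → ∃ p ∈ Literature.MathematicalPhysics.StatisticalMechanics.barlowStacking a h s, dist (x N j) (x N i + A (p - z)) ≤ ε)) ∧ ¬ (∃ a h : ℝ, 1 / 2 < a ∧ a < 2 ∧ 1 / 2 < h ∧ h < 2 ∧ ∃ z ∈ Literature.MathematicalPhysics.StatisticalMechanics.hcpStacking a h, ∃ A : EuclideanSpace ℝ (Fin 3) →ₗᵢ[ℝ] EuclideanSpace ℝ (Fin 3), (∀ p ∈ Literature.MathematicalPhysics.StatisticalMechanics.hcpStacking a h, dist p z ≤ R → ∃ j : Fin N, dist (x N j) (x N i + A (p - z)) ≤ ε) ∧ (∀ j : Fin N, dist (x N j) (x N i) ≤ R → ∃ p ∈ Literature.MathematicalPhysics.StatisticalMechanics.hcpStacking a h, dist (x N j) (x N i + A (p - z)) ≤ ε))} : ℝ) / N) Filter.atTop (nhds 0)) → (∃ P : Literature.MathematicalPhysics.StatisticalMechanics.PeriodicConfiguration 3, ∀ R ε : ℝ, 0 < R → 0 < ε → ∃ R' ε' : ℝ, 0 < R' ∧ 0 < ε' ∧ ε' < 1 / 4 ∧ ∀ x : (N : ℕ) → (Fin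 N → EuclideanSpace ℝ (Fin 3)), (∀ N, Literature.MathematicalPhysics.StatisticalMechanics.IsGroundState Literature.MathematicalPhysics.StatisticalMechanics.lennardJones (x N)) → Filter.Tendsto (fun N : ℕ => (Nat.card {i : Fin N // (∃ a h : ℝ, 1 / 2 < a ∧ a < 2 ∧ 1 / 2 < h ∧ h < 2 ∧ ∃ z ∈ Literature.MathematicalPhysics.StatisticalMechanics.hcpStacking a h, ∃ A : EuclideanSpace ℝ (Fin 3) →ₗᵢ[ℝ] EuclideanSpace ℝ (Fin 3), (∀ p ∈ Literature.MathematicalPhysics.StatisticalMechanics.hcpStacking a h, dist p z ≤ R' → ∃ j : Fin N, dist (x N j) (x N i + A (p - z)) ≤ ε') ∧ (∀ j : Fin N, dist (x N j) (x N i) ≤ R' → ∃ p ∈ Literature.MathematicalPhysics.StatisticalMechanics.hcpStacking a h, dist (x N j) (x N i + A (p - z)) ≤ ε')) ∧ ¬ (∃ A : EuclideanSpace ℝ (Fin 3) →ₗᵢ[ℝ] EuclideanSpace ℝ (Fin 3), (∀ p ∈ P.points, ‖p‖ ≤ R → ∃ j : Fin N, dist (x N j) (x N i + A p) ≤ ε)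 ∧ (∀ j : Fin N, dist (x N j) (x N i) ≤ R → ∃ p ∈ P.points, dist (x N j) (x N i + A p) ≤ ε))} : ℝ) / N) Filter.atTop (nhds 0)) → Summit.AtomisticToContinuum.Crystallization.Theses.ThreeConeCertificate.BulkDefectVanish :=
  fun hL hF hS => BulkDefectVanish_of hL hF hS

/-- Same composition, concluding the `FrustrationRangeCertificates` copy of the shared item 0751. -/
theorem BulkDefectVanish_ofFRC : (∀ R ε : ℝ, 0 < R → 0 < ε → ε < 1 / 4 → ∀ x : (N : ℕ) → (Fin N → EuclideanSpace ℝ (Fin 3)), (∀ N, Literature.MathematicalPhysics.StatisticalMechanics.IsGroundState Literature.MathematicalPhysics.StatisticalMechanics.lennardJones (x N)) → Filter.Tendsto (fun N : ℕ => (Nat.card {i : Fin N // ¬ (∃ a h : ℝ, 1 / 2 < a ∧ a < 2 ∧ 1 / 2 < h ∧ h < 2 ∧ ∃ s : ℤ → ℤ, Literature.MathematicalPhysics.StatisticalMechanics.IsHaggSeq s ∧ ∃ z ∈ Literature.MathematicalPhysics.StatisticalMechanics.barlowStacking a h s, ∃ A : EuclideanSpace ℝ (Fin 3) →ₗᵢ[ℝ]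 EuclideanSpace ℝ (Fin 3), (∀ p ∈ Literature.MathematicalPhysics.StatisticalMechanics.barlowStacking a h s, dist p z ≤ R → ∃ j : Fin N, dist (x N j) (x N i + A (p - z)) ≤ ε) ∧ (∀ j : Fin N, dist (x N j) (x N i) ≤ R → ∃ p ∈ Literature.MathematicalPhysics.StatisticalMechanics.barlowStacking a h s, dist (x N j) (x N i + A (p - z)) ≤ ε))} : ℝ) / N) Filter.atTop (nhds 0)) → (∀ R ε : ℝ, 0 < R → 0 < ε → ε < 1 / 4 → ∀ x : (N : ℕ) → (Fin N → EuclideanSpace ℝ (Fin 3)), (∀ N, Literature.MathematicalPhysics.StatisticalMechanics.IsGroundState Literature.MathematicalPhysics.StatisticalMechanics.lennardJones (x N)) → Filter.Tendsto (fun N : ℕ => (Nat.card {i : Fin N // (∃ a h : ℝ, 1 / 2 < a ∧ a < 2 ∧ 1 / 2 < h ∧ h < 2 ∧ ∃ s : ℤ → ℤ, Literature.MathematicalPhysics.StatisticalMechanics.IsHaggSeq s ∧ ∃ z ∈ Literature.MathematicalPhysics.StatisticalMechanics.barlowStacking a h s, ∃ A : EuclideanSpace ℝ (Fin 3) →ₗᵢ[ℝ]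 EuclideanSpace ℝ (Fin 3), (∀ p ∈ Literature.MathematicalPhysics.StatisticalMechanics.barlowStacking a h s, dist p z ≤ R → ∃ j : Fin N, dist (x N j) (x N i + A (p - z)) ≤ ε) ∧ (∀ j : Fin N, dist (x N j) (x N i) ≤ R → ∃ p ∈ Literature.MathematicalPhysics.StatisticalMechanics.barlowStacking a h s, dist (x N j) (x N i + A (p - z)) ≤ ε)) ∧ ¬ (∃ a h : ℝ, 1 / 2 < a ∧ a < 2 ∧ 1 / 2 < h ∧ h < 2 ∧ ∃ z ∈ Literature.MathematicalPhysics.StatisticalMechanics.hcpStacking a h, ∃ A : EuclideanSpace ℝ (Fin 3) →ₗᵢ[ℝ] EuclideanSpace ℝ (Fin 3), (∀ p ∈ Literature.MathematicalPhysics.StatisticalMechanics.hcpStacking a h, dist p z ≤ R → ∃ j : Fin N, dist (x N j) (x N i + A (p - z)) ≤ ε) ∧ (∀ j : Fin N, dist (x N j) (x N i) ≤ R → ∃ p ∈ Literature.MathematicalPhysics.StatisticalMechanics.hcpStacking a h, dist (x N j) (x N i + A (p - z)) ≤ ε))} : ℝ) / N) Filter.atTop (nhds 0)) → (∃ P : Literature.MathematicalPhysics.StatisticalMechanics.PeriodicConfiguration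 3, ∀ R ε : ℝ, 0 < R → 0 < ε → ∃ R' ε' : ℝ, 0 < R' ∧ 0 < ε' ∧ ε' < 1 / 4 ∧ ∀ x : (N : ℕ) → (Fin N → EuclideanSpace ℝ (Fin 3)), (∀ N, Literature.MathematicalPhysics.StatisticalMechanics.IsGroundState Literature.MathematicalPhysics.StatisticalMechanics.lennardJones (x N)) → Filter.Tendsto (fun N : ℕ => (Nat.card {i : Fin N // (∃ a h : ℝ, 1 / 2 < a ∧ a < 2 ∧ 1 / 2 < h ∧ h < 2 ∧ ∃ z ∈ Literature.MathematicalPhysics.StatisticalMechanics.hcpStacking a h, ∃ A : EuclideanSpace ℝ (Fin 3) →ₗᵢ[ℝ] EuclideanSpace ℝ (Fin 3), (∀ p ∈ Literature.MathematicalPhysics.StatisticalMechanics.hcpStacking a h, dist p z ≤ R' → ∃ j : Fin N, dist (x N j) (x N i + A (p - z)) ≤ ε') ∧ (∀ j : Fin N, dist (x N j) (x N i) ≤ R' → ∃ p ∈ Literature.MathematicalPhysics.StatisticalMechanics.hcpStacking a h, dist (x N j) (x N i + A (p - z)) ≤ ε')) ∧ ¬ (∃ A : EuclideanSpace ℝ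 (Fin 3) →ₗᵢ[ℝ] EuclideanSpace ℝ (Fin 3), (∀ p ∈ P.points, ‖p‖ ≤ R → ∃ j : Fin N, dist (x N j) (x N i + A p) ≤ ε) ∧ (∀ j : Fin N, dist (x N j) (x N i) ≤ R → ∃ p ∈ P.points, dist (x N j) (x N i + A p) ≤ ε))} : ℝ) / N) Filter.atTop (nhds 0)) → Summit.AtomisticToContinuum.Crystallization.Theses.FrustrationRangeCertificates.BulkDefectVanish :=
  fun hL hF hS => BulkDefectVanish_of hL hF hS

/-- The shared copies, modulo the three stubs. -/
theorem BulkDefectVanish_skeletonLT : Summit.AtomisticToContinuum.Crystallization.Theses.LuttingerTiszaRegistry.BulkDefectVanish :=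
  BulkDefectVanish_ofLT stub_laminarBarlowWindows stub_stackingFaultSparsity stub_hcpTemplateLock

theorem BulkDefectVanish_skeletonTCC : Summit.AtomisticToContinuum.Crystallization.Theses.ThreeConeCertificate.BulkDefectVanish :=
  BulkDefectVanish_ofTCC stub_laminarBarlowWindows stub_stackingFaultSparsity stub_hcpTemplateLock

theorem BulkDefectVanish_skeletonFRC : Summit.AtomisticToContinuum.Crystallization.Theses.FrustrationRangeCertificates.BulkDefectVanish :=
  BulkDefectVanish_ofFRC stub_laminarBarlowWindows stub_stackingFaultSparsity stub_hcpTemplateLock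

/-- Same composition, concluding the copy in the RETIRED route `CrystalKissingRigidity` (closed
2026-08-15, not-a-thesis; file kept as record) — still the default decl of the shared item 0751 for
`ledger skeleton check`. -/
theorem BulkDefectVanish_ofCKR : (∀ R ε : ℝ, 0 < R → 0 < ε → ε < 1 / 4 → ∀ x : (N : ℕ) → (Fin N → EuclideanSpace ℝ (Fin 3)), (∀ N, Literature.MathematicalPhysics.StatisticalMechanics.IsGroundState Literature.MathematicalPhysics.StatisticalMechanics.lennardJones (x N)) → Filter.Tendsto (fun N : ℕ => (Nat.card {i : Fin N // ¬ (∃ a h : ℝ, 1 / 2 < a ∧ a < 2 ∧ 1 / 2 < h ∧ h < 2 ∧ ∃ s : ℤ → ℤ, Literature.MathematicalPhysics.StatisticalMechanics.IsHaggSeq s ∧ ∃ z ∈ Literature.MathematicalPhysics.StatisticalMechanics.barlowStacking a h s, ∃ A : EuclideanSpace ℝ (Fin 3) →ₗᵢ[ℝ] EuclideanSpace ℝ (Fin 3), (∀ p ∈ Literature.MathematicalPhysics.StatisticalMechanics.barlowStacking a h s, dist p z ≤ R → ∃ j : Fin N, dist (x N j) (x N i + A (p - z)) ≤ ε) ∧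 (∀ j : Fin N, dist (x N j) (x N i) ≤ R → ∃ p ∈ Literature.MathematicalPhysics.StatisticalMechanics.barlowStacking a h s, dist (x N j) (x N i + A (p - z)) ≤ ε))} : ℝ) / N) Filter.atTop (nhds 0)) → (∀ R ε : ℝ, 0 < R → 0 < ε → ε < 1 / 4 → ∀ x : (N : ℕ) → (Fin N → EuclideanSpace ℝ (Fin 3)), (∀ N, Literature.MathematicalPhysics.StatisticalMechanics.IsGroundState Literature.MathematicalPhysics.StatisticalMechanics.lennardJones (x N)) → Filter.Tendsto (fun N : ℕ => (Nat.card {i : Fin N // (∃ a h : ℝ, 1 / 2 < a ∧ a < 2 ∧ 1 / 2 < h ∧ h < 2 ∧ ∃ s : ℤ → ℤ, Literature.MathematicalPhysics.StatisticalMechanics.IsHaggSeq s ∧ ∃ z ∈ Literature.MathematicalPhysics.StatisticalMechanics.barlowStacking a h s, ∃ A : EuclideanSpace ℝ (Fin 3) →ₗᵢ[ℝ] EuclideanSpace ℝ (Fin 3), (∀ p ∈ Literature.MathematicalPhysics.StatisticalMechanics.barlowStacking a h s, dist p z ≤ R → ∃ j : Fin N, dist (x N j) (x N i + A (p - z)) ≤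 ε) ∧ (∀ j : Fin N, dist (x N j) (x N i) ≤ R → ∃ p ∈ Literature.MathematicalPhysics.StatisticalMechanics.barlowStacking a h s, dist (x N j) (x N i + A (p - z)) ≤ ε)) ∧ ¬ (∃ a h : ℝ, 1 / 2 < a ∧ a < 2 ∧ 1 / 2 < h ∧ h < 2 ∧ ∃ z ∈ Literature.MathematicalPhysics.StatisticalMechanics.hcpStacking a h, ∃ A : EuclideanSpace ℝ (Fin 3) →ₗᵢ[ℝ] EuclideanSpace ℝ (Fin 3), (∀ p ∈ Literature.MathematicalPhysics.StatisticalMechanics.hcpStacking a h, dist p z ≤ R → ∃ j : Fin N, dist (x N j) (x N i + A (p - z)) ≤ ε) ∧ (∀ j : Fin N, dist (x N j) (x N i) ≤ R → ∃ p ∈ Literature.MathematicalPhysics.StatisticalMechanics.hcpStacking a h, dist (x N j) (x N i + A (p - z)) ≤ ε))} : ℝ) / N) Filter.atTop (nhds 0)) → (∃ P : Literature.MathematicalPhysics.StatisticalMechanics.PeriodicConfiguration 3, ∀ R ε : ℝ, 0 < R → 0 < ε → ∃ R' ε' : ℝ, 0 < R' ∧ 0 < ε' ∧ ε' < 1 /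 4 ∧ ∀ x : (N : ℕ) → (Fin N → EuclideanSpace ℝ (Fin 3)), (∀ N, Literature.MathematicalPhysics.StatisticalMechanics.IsGroundState Literature.MathematicalPhysics.StatisticalMechanics.lennardJones (x N)) → Filter.Tendsto (fun N : ℕ => (Nat.card {i : Fin N // (∃ a h : ℝ, 1 / 2 < a ∧ a < 2 ∧ 1 / 2 < h ∧ h < 2 ∧ ∃ z ∈ Literature.MathematicalPhysics.StatisticalMechanics.hcpStacking a h, ∃ A : EuclideanSpace ℝ (Fin 3) →ₗᵢ[ℝ] EuclideanSpace ℝ (Fin 3), (∀ p ∈ Literature.MathematicalPhysics.StatisticalMechanics.hcpStacking a h, dist p z ≤ R' → ∃ j : Fin N, dist (x N j) (x N i + A (p - z)) ≤ ε') ∧ (∀ j : Fin N, dist (x N j) (x N i) ≤ R' → ∃ p ∈ Literature.MathematicalPhysics.StatisticalMechanics.hcpStacking a h, dist (x N j) (x N i + A (p - z)) ≤ ε')) ∧ ¬ (∃ A : EuclideanSpace ℝ (Fin 3) →ₗᵢ[ℝ] EuclideanSpace ℝ (Fin 3), (∀ p ∈ P.points, ‖p‖ ≤ R → ∃ j : Fin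 N, dist (x N j) (x N i + A p) ≤ ε) ∧ (∀ j : Fin N, dist (x N j) (x N i) ≤ R → ∃ p ∈ P.points, dist (x N j) (x N i + A p) ≤ ε))} : ℝ) / N) Filter.atTop (nhds 0)) → Summit.AtomisticToContinuum.Crystallization.Theses.CrystalKissingRigidity.BulkDefectVanish :=
  fun hL hF hS => BulkDefectVanish_of hL hF hS

/-- The item's default decl (CrystalKissingRigidity copy), modulo the three stubs — the
`<Crux>_proof` theorem `ledger skeleton check` looks for without `--crux-decl`. -/
theorem BulkDefectVanish_proof : Summit.AtomisticToContinuum.Crystallization.Theses.CrystalKissingRigidity.BulkDefectVanish :=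
  BulkDefectVanish_ofCKR stub_laminarBarlowWindows stub_stackingFaultSparsity stub_hcpTemplateLock

end Summit.AtomisticToContinuum.Crystallization.Cruxes.BulkDefectVanish.Birth
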